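/-
Copyright: publication-cell `pub-balaban` (b2b), seat b2b-balaban-b10 gen 21 (v1).  Literature leaf — the algebra and
elementary analysis of conjugation and of the exponential map in a unital C⋆-algebra, one-variable differentiability,
finite sums and `2 × 2` matrix arithmetic only; every theorem is kernel-proved and tagged [folklore] or [cite: …] (a
LOCATED printed shape); the objects are the MODEL OBJECTS of `…B10Eq29TubeLine` / `…B10Eq61Leaves` (`Tube`, `TubeCfg`,
`expLine`, `expChart`), never asserted to be Bałaban's; NO new cited facts, NO new quotation, NO summit vocabulary.
-/
import Mathlib
import Literature.MathematicalPhysics.QuantumFieldTheory.Balaban1983to89.B10Eq29CplxLine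

/-!
# `Balaban1983to89.B10Eq31GlobalConj` — [Balaban1985UV3] (26) p. 263 and (31)–(32) p. 264 FOR THE CONSTANT GAUGE
# TRANSFORMATIONS, in the C⋆-algebra model: the global conjugation `V ↦ (W·V_b·W⋆)_b` read in the exponential chart
# at the subtraction point `U ≡ 1` of (61), its one-parameter groups `t ↦ Ad exp(tY)` with generators `ad_Y`, the
# detected span = the per-bond commutators; the three SYMMETRY binders (`hTd`, `hinv`, `hmem`) of
# `B10Eq61Leaves.…_of_mem_closure` / `B10Eq29CplxLine.…_cplx_of_mem_closure` DISCHARGED from "`E X` is a class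
# function on the tube" + "every bond generator lies in the closed span of commutators"; `commSpan M₂(ℂ) = 𝔰𝔩₂`; and a
# joint instance over `M₂(ℂ)` with a complex, NON-COMMUTING background whose differenced family is `−4 ≠ 0`

T. Bałaban, *Ultraviolet stability of three-dimensional lattice pure gauge field theories*, Commun. Math. Phys. **102**,
255–275 (1985) [Balaban1985UV3] (cell paper B10; PDF `paper:balaban1985-cmp102-uv-stability-3d`, journal page = PDF
page + 254); T. Bałaban, *Renormalization group approach to lattice gauge field theories. I*, Commun. Math. Phys.
**109**, 249–301 (1987) [Balaban1987RG1] = [I]; *… II*, Commun. Math. Phys. **116**, 1–22 (1988)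
[Balaban1988RG2Cluster] = [II].  All quotations in §0 are RE-KEYED from the §0 of the tree modules
`…B13DerivZeroGauge` (v1.1, b13 lineage; renders `1985-cmp102-uv-stability-3d-p009`, `-p010`, `-p018`,
`1987-cmp109-rg-I-small-field-p015`, `-p035`, `1988-cmp116-rg-II-cluster-p021`, `-p022`, READ AS IMAGES there) and
`…B10Eq29CplxLine` (v1; render `1987-cmp109-rg-I-small-field-p014-x2`); this module adds NO new quotation and NO cited
fact.  Siblings (imported BY NAME, byte-identical, nothing edited): `…B10Eq29CplxLine` (hence `…B10Eq61Leaves`,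
`…B10Eq29TubeLine`, `…B10Eq61PerSite`, b13's `…B13DerivZeroGauge`): `Tube`, `TubeCfg`, `expLine`, `expChart`,
`diffAlongV`, `B13.LogHalfBound`, `B13.Bound118`, `B13.VolBoundK1`, `logHalfBound_expLine_of_mem_closure`,
`logHalfBound_expLine_cplx_of_mem_closure`, `bound118_secondOrder_expLine_cplx_of_mem_closure`, the `M₂(ℂ)` data `M₂`,
`trCLM`, `mA = E₁₂`, `mC`, `mK = [A, C] = diag(iπ, −iπ)`, `m2E = tr`, `example_logHalfBound_m2E`, `mJ`, `mX = σₓ`.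

WHY THIS MODULE (the b10 lineage's open edge after `B10Eq29CplxLine` v1: cell GAPS C-b10g20-1, README gen 20 «How to
continue (gen 21)» node 1 + 2(b)(c)).  The join theorems of the lineage —
`B10Eq61Leaves.logHalfBound_expLine_of_mem_closure` (real background) and
`B10Eq29CplxLine.logHalfBound_expLine_cplx_of_mem_closure` / `bound118_secondOrder_expLine_cplx_of_mem_closure`
(complex background) — supply (L1′)/(L2′) from the tube geometry and take (L3′) from b13's chart theorem, but leave the
SYMMETRY DATA abstract: a family of chart-linear flows `T l t` with velocities `L l` (`hTd`), invariance of
`E X ∘ expChart base₀ X` under them on a ball (`hinv`), and the generator configuration in the closed span of the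
ranges of the `L l` (`hmem`).  `B10Eq61Leaves` §4 instantiated them once, for ONE inner flow of `M₂(ℂ)` (conjugation
by `exp(tE₁₂)`) and a SKEW generator `K ∈ range(ad_{E₁₂})`.  The print derives (32) from exactly two ingredients
(p. 264, §0): the gauge invariance (26) *"implies the invariance with respect to the global transformations R(U),
U ∈ G"* — (31) — and *"by the assumption that 𝔤 is semi-simple, the only element invariant is 0"*.  This module puts
BOTH ingredients into the model, for a general unital C⋆-algebra `𝔸` and any finite bond set `ι`, and discharges the
three binders from them.  (§1) THE GLOBAL CONJUGATION `conjCfg W W′ : v ↦ (W·v_b·W′)_b` (a continuous ℂ-linear map of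
configurations — the constant gauge transformation `u ≡ W`, for which `u(b₋)·V_b·u(b₊)⁻¹ = W·V_b·W⁻¹` at every bond),
its one-parameter groups `gaugeFlow Y t = conjCfg (exp tY) (exp(−tY))` with velocity `adCfg Y : v ↦ ([Y, v_b])_b` at
`t = 0` (`hasDerivAt_gaugeFlow` — the `hTd` binder), and THE CHART POINT: `exp` intertwines conjugation
(`exp(W x W′) = W·exp(x)·W′`, Mathlib `exp_units_conj`), so AT THE BASE POINT `1` the chart `v ↦ (exp(v_b)·1)_b`
carries the linear action `conjCfg` to the configuration-level conjugation (`expChart_one_conjCfg`) — the global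
action is LINEAR IN THE CHART ONLY AT ITS FIXED POINT `U ≡ 1`, which is the subtraction point `U_{k+1} = 1` of (61)
and of [II] p. 21's `[log Z⁽ᵏ⁾(U_{k+1}) − log Z⁽ᵏ⁾(1)]` (p. 272, §0; at a base `U₀` not fixed by the action,
`W·exp(v)·U₀·W⋆ = exp(WvW⋆)·(WU₀W⋆)` moves the base — cell GAPS C-adv2-66 R1 — so every theorem here is at base `1`);
hence invariance of `E X` under the conjugations by `exp(tY_l)` ON THE BONDWISE TUBE `TubeCfg ι 𝔸 a` (itself
conjugation invariant, `conj_mem_tubeCfg`; the chart maps the ball of radius `a` into it, `expChart_one_mem_tubeCfg`)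
gives the `hinv` binder (`expChart_one_invariant_of_flowInvariant`), and for SKEW-ADJOINT `Y` (`exp(tY)` unitary,
`exp(tY)⋆ = exp(−tY)`) it follows from invariance under conjugation by all unitaries — "`E X` is a class function"
(`flowInvariant_of_classFn`).  (§2) THE DETECTED SPAN: `ad_Y` of a configuration supported at one bond is the
commutator there (`adCfg_single`), so if every bond value of the generator lies in the closed ℂ-span of the
commutators `{[Y_l, y]}`, the configuration lies in the closed span of the ranges of the `ad_{Y_l}` — the `hmem`
binder (`mem_closure_span_range_adCfg`; a finite sum of `Pi.single`s, continuity of `Pi.single b`); and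
`comm_mem_commSpan`: over ℂ EVERY commutator `[a, y]` already lies in `commSpan 𝔸 = span{[S, y] : S⋆ = −S}`
(`a = ℜa + i·ℑa`, `[H, y] = −i[iH, y]`) — the model form of [I] p. 283 (*"implied by the invariance with respect to
G-valued transformations"*): the complexified directions `A′ ∈ 𝔤ᶜ` of [I] (1.13) are detected by the compact group.
(§3) THE JOINT THEOREMS with `hTd`/`hinv`/`hmem` supplied, in FLOW FORM (any family `Y : Λ → 𝔸` — a subgroup
`G ⊊ U(𝔸)` through its Lie algebra, or `𝔤ᶜ`) and in CLASS-FUNCTION FORM (all unitaries of `𝔸`): complex background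
(`logHalfBound_expLine_cplx_of_flowInvariant` / `_of_classFn`, constant `8·((2p + q)/(min(1/8, a/2) − p))²·B`, rate
`r − 2`; `bound118_secondOrder_expLine_cplx_of_flowInvariant` / `_of_classFn`, [II]'s letters under printed R21,
constant `(64A(1 + c₀²)/(min(1/8, a/2) − α₁)²)·c₁`, rate `r − 3`) and real background
(`logHalfBound_expLine_of_flowInvariant` / `_of_classFn`, constant `8((p + q)/a)²·B`).  Remaining binders: the
generator split / size, `TubeCfg ι 𝔸 a ⊆ sp X` + holomorphy ON THE SAME `sp` (WHICH SPACE, `…B10Eq29TubeLine` HONEST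
SCOPE (iii)), the class-function / flow invariance of `E X` on the tube, the per-bond commutator membership, the
undifferenced bound (and for (I.1.18) the volume bound).  (§4) `M₂(ℂ)` (operator norm,
`…B10Eq29TubeLine.cstarAlgebraMatrix 2` threaded by `letI`, nothing registered as an instance): `coe_commSpan_m2` —
THE DETECTED SPAN IS `𝔰𝔩₂ = 𝔰𝔲(2)ᶜ`, the traceless matrices (`E₁₂ = [E₁₁, E₁₂]`, `E₂₁ = [E₂₁, E₁₁]`,
`E₁₁ − E₂₂ = [E₁₂, E₂₁]`; a commutator is traceless): the centre `ℂ·1` of `𝔲(2)ᶜ` is NOT detected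
(`B10Eq61Leaves.example_fderiv_apply_center`: the derivative of `tr ∘ expChart` along `1` is `2`), in accordance with
the printed use of semi-simplicity; `m2E_conj` — `tr` IS A CLASS FUNCTION; and the JOINT NON-VACUITY WITH THE COMPLEX
PART OF THE BACKGROUND SWITCHED ON AND NON-COMMUTING: generator `K + E₁₂/16` — real part `K = iπ(E₁₁ − E₂₂)` skew,
complex part `E₁₂/16` nilpotent, NOT skew (`mA_not_mem_skewAdjoint`), NOT commuting with `K` (`mK_mul_mA_ne`), of norm
`≤ 1/16` (`E₁₂ = (σₓ + J)/2`, two unitaries) — every binder of `logHalfBound_expLine_cplx_of_classFn` DERIVED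
(`p = 1/16`, `q = ‖K‖`, tube half-width `a = 1`, `B = 3‖tr‖`, `r = 0`; `example_logHalfBound_expLine_cplx_m2`), and
the differenced family at `1` EQUALS `tr exp(K + E₁₂/16) − tr 1 = −4` (`example_diffAlongV_cplx_m2`), because
`K + cE₁₂ = W·K·W⁻¹` for the unipotent `W = 1 − (c/2πi)E₁₂` (`unipU_conj_mK`), so `exp(K + cE₁₂) = W·exp(K)·W⁻¹ = −1`
for EVERY `c` (`exp_mK_add_smul_mA`).

CITATION HEADER (lean-in-tree rule).  WHAT IS REPRODUCED (verbatim, §0): [Balaban1985UV3] p. 263 ((26), (29)),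
p. 264 ((31)–(32) with the semi-simplicity sentence), p. 272 (the cancellation at `U_{k+1} = 1`); [Balaban1987RG1]
p. 262 ((1.11)–(1.13)), p. 263 ((1.19)), p. 283 (Gᶜ-invariance implied by G-invariance); [Balaban1988RG2Cluster]
pp. 21–22 (invariance extended by analyticity; constancy on orbits) — all already in `B13DerivZeroGauge` §0 (v1.1) /
`B10Eq29CplxLine` §0 (v1); this module adds NO quotation and NO cited fact.

WHAT IS KERNEL-CERTIFIED (algebra of conjugation and of `exp` in a unital C⋆-algebra, one-variable differentiability,
finite sums, `2 × 2` matrix arithmetic — no object of the papers is constructed):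
* §1 [folklore] — THE GLOBAL CONJUGATION IN THE CHART: `conjCfg W W′` (CLM, any index type), `conjCfg_apply`;
  `adCfg Y = conjCfg Y 1 − conjCfg 1 Y`, `adCfg_apply`, `adCfg_single` (`ad_Y (Pi.single b x) = Pi.single b [Y, x]`);
  `exp_smul_mul_exp_smul_neg` / `exp_smul_neg_mul_exp_smul` (`exp(cY)·exp(−cY) = 1`, ℚ-structure by restriction of
  scalars); `exp_conj_of_mul_eq_one` (`WW′ = W′W = 1 ⇒ exp(WxW′) = W·exp x·W′`); `gaugeFlow Y t`, `gaugeFlow_apply`;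
  `conj_mem_tube` / `conj_mem_tubeCfg` (unitary conjugation preserves `Tube 𝔸 a` / `TubeCfg ι 𝔸 a`:
  `‖WBW⋆‖ = ‖B‖` by `CStarRing.norm_mem_unitary_mul` / `norm_mul_mem_unitary`); `expChart_one_conjCfg` /
  `expChart_one_gaugeFlow` (THE CHART POINT at base `1`); `hasDerivAt_gaugeFlow` (velocity `adCfg Y w` at `t = 0`);
  `expChart_one_mem_tubeCfg` (ball of radius `a` ↦ bondwise tube of half-width `a`);
  `expChart_one_invariant_of_flowInvariant` (flow invariance of `E X` on the tube ⇒ `hinv`); `star_exp_ofReal_smul`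
  (`S` skew, `t` real ⇒ `exp(tS)⋆ = exp(t(−S))`); `flowInvariant_of_classFn` (class function ⇒ flow invariance for all
  skew generators, `B10Eq29TubeLine.exp_ofReal_smul_mem_unitary`).
* §2 [folklore] — THE DETECTED SPAN: `single_mem_closure_span_range_adCfg`, `mem_closure_span_range_adCfg` (per-bond
  membership in the closed span of `{[Y_l, y]}` ⇒ `hmem`; `Finset.univ_sum_single`, `continuous_single`,
  `Submodule.topologicalClosure`); `commSpan 𝔸 = span{[S, y] : S ∈ skewAdjoint 𝔸}`; `I_smul_mem_skewAdjoint`,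
  `comm_eq_neg_I_smul_comm`, `comm_mem_commSpan` (EVERY `[a, y] ∈ commSpan 𝔸`; Mathlib
  `realPart_add_I_smul_imaginaryPart`).
* §3 — THE JOINT THEOREMS AT BASE `1`: `logHalfBound_expLine_cplx_of_flowInvariant`,
  `bound118_secondOrder_expLine_cplx_of_flowInvariant`, `logHalfBound_expLine_of_flowInvariant` (flow form, any
  `Y : Λ → 𝔸`) and `logHalfBound_expLine_cplx_of_classFn`, `bound118_secondOrder_expLine_cplx_of_classFn`,
  `logHalfBound_expLine_of_classFn` (class-function form) — one-line applications of the lineage's `…_of_mem_closure`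
  theorems with `T := gaugeFlow`, `L := adCfg`, `α := a`, base `1`.
* §4 — `M₂(ℂ)`: `mE11`, `mE21`, `mE11_comm_mA`, `mE21_comm_mE11`, `mA_comm_mE21`, `mA_mul_mA` (`E₁₂² = 0`),
  `mK_mul_mA_ne`, `mA_not_mem_skewAdjoint`, `mJ_mem_unitary`, `two_smul_mA` (`2E₁₂ = σₓ + J`), `norm_mA_le`
  (`‖E₁₂‖ ≤ 1`), `unipU d = 1 + dE₁₂` (a unit, inverse `1 − dE₁₂`), `unipU_conj_mK` (`W_d K W_d⁻¹ = K − 2d(iπ)E₁₂`),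
  `exp_mK` (`exp K = −1`), `exp_mK_add_smul_mA` (`exp(K + cE₁₂) = −1` for every `c`), `m2E_conj` (`tr` is a class
  function), `coe_commSpan_m2` (`commSpan M₂(ℂ) =` the traceless matrices), `m2GenC = K + E₁₂/16`, `m2GenC_split`,
  `m2GenC_mem_closure`, `example_logHalfBound_expLine_cplx_m2` (every binder of `logHalfBound_expLine_cplx_of_classFn`,
  constant `8·((2/16 + ‖K‖)/(min(1/8, 1/2) − 1/16))²·3‖tr‖`, rate `0 − 2`), `example_diffAlongV_cplx_m2` (`= −4`).

HONEST SCOPE.  (i) MODEL, NOT THE PAPER'S OBJECTS — as `…B10Eq29TubeLine` / `…B10Eq29CplxLine` HONEST SCOPE (i):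
one bond = one unital C⋆-algebra, the tube `{exp(B)·U}`, none of the derivative / averaging conditions of [5]
(3.35)–(3.37), [I] (i)–(iii).  (ii) CONSTANT GAUGE TRANSFORMATIONS ONLY: the printed (26) / (1.19) is invariance
under ALL (x-dependent, G- resp. Gᶜ-valued) gauge transformations `u`, acting at a bond by `u(b₋)·V_b·u(b₊)⁻¹`; only
the constant ones `u ≡ W` act by one fixed conjugation at every bond, and only these are modelled (`conjCfg W W⋆`) —
which is what (31) uses (*"the global transformations R(U), U ∈ G"*).  (iii) BASE POINT `1` ONLY: the conjugation is
linear in the exponential chart only at its fixed point; the theorems are stated with `base₀ ≡ 1` (the printed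
subtraction point, p. 272), not for the general unitary `base₀ X` of the lineage's `…_of_mem_closure`.  (iv) WHAT IS
DETECTED: the hypotheses detect, per bond, the closed span of commutators — for `𝔸 = M_N(ℂ)` and all unitaries this
is `𝔰𝔩_N`, NOT `𝔤𝔩_N`: the centre is invisible to conjugations (`B10Eq61Leaves.example_fderiv_apply_center`), exactly
the rôle of *"𝔤 is semi-simple"* in print; for a subgroup `G ⊊ U(N)` the flow form applies with `Y` ranging over
(generators of) `𝔤`, and `[𝔤, M_N] ⊇ [𝔤ᶜ, 𝔤ᶜ] = 𝔤ᶜ` for `𝔤` semi-simple is b13's abstract Lie fact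
(`B12Ward414.span_range_adConst_eq_top_of_isSemisimple`), not re-proved here for matrices; `coe_commSpan_m2` is the
`N = 2`, `G = U(2)` case by hand.  (v) For the ACTUAL localized (61)/(63)-pieces, their invariance (26), the
per-bond membership `𝓗(B)_b ∈ 𝔤` (resp. `A′ ∈ 𝔤ᶜ`), the undifferenced bound, the volume bound, `A`, `a`, `c₀`, `c₁`
are HYPOTHESES (cell GAPS C-B13-32 / C-adv2-63 R1 / C-b10g19-2 (iii)); the class-function hypothesis is posed on the
bondwise tube `TubeCfg ι 𝔸 a ⊆ sp X` (invariance on all of `sp X` suffices a fortiori).  (vi) THE NUMBERS ARE THE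
MODEL'S (`1/8`, the factor `2`, `B = 3‖tr‖`, `p = 1/16`, `‖K‖ = π`); the example exercises the `p`-slot with a
complex part that neither commutes with the real part nor is normal, and its differenced family is computed exactly
(`−4`), so the bound is not attained vacuously.  (vii) The module is NOT a proof of (24), (61)–(63), (I.1.18) or
Theorem 2, and NOT summit progress.  (viii) Not done here (README gen 20 nodes 2(a), 3–6): a TRUE `B13.Consts`
R21-instance fed to `bound118_…`, the two-regime re-join, the located `hmem`/`hinv` for the printed pieces via the
`B10Eq24Cumulant` interfaces, general-`N` `𝔰𝔩_N`.

## §0. The printed sentences (verbatim; all already in `B13DerivZeroGauge` §0 (v1.1) / `B10Eq29CplxLine` §0 (v1),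
read off the renders there; re-keyed, nothing new)

[Balaban1985UV3] = T. Bałaban, *Ultraviolet stability of three-dimensional lattice pure gauge field theories*, Commun.
Math. Phys. **102** (1985) 255–275.
* p. 263 (render `1985-cmp102-uv-stability-3d-p009`): *"equalities hold 𝒫′₁(g₀, X, U₁^𝓊) = 𝒫′₁(g₀, X, U₁), (26) for all
  gauge transformations 𝓊. The second is a localization property with respect to U₁. … The third property is the
  analyticity with respect to U₁. These properties follow from the results of previous papers"*; *"By the gauge
  invariance (26), we have 𝒫′₁(g₀, X, U₁) = 𝒫′₁(g₀, X, exp i𝓗(B)), (29) and we expand the function with respect to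
  𝓗(B)."*
* p. 264 (render `…-p010`): *"The gauge invariance (26) implies the invariance with respect to the global transformations
  R(U), U ∈ G, hence the equality R(U)((δ/δ𝓗(b))𝒫′₁)(g₀, X, 1) = ((δ/δ𝓗(b))𝒫′₁)(g₀, X, 1). (31) We have to notice
  only that (26) holds for all regular gauge field configurations, not only for the minimal configurations U₁. The
  derivative in the above formula is an element of the Lie algebra 𝔤, and by the assumption that 𝔤 is semi-simple, the
  only element invariant is 0, and we conclude ((δ/δ𝓗(b))𝒫′₁)(g₀, X, 1) = 0. (32) It is the only place we use the
  semi-simplicity, but the above conclusion is a fundamental point in our method. In the renormalization group language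
  it is the statement that there are no relevant variables in the effective action."*
* p. 272 (render `…-p018`, after (63)): *"Now let us notice that gathering
  together the first terms in the expansions (30) we obtain the expansion of (63) for the external field U_{k+1} = 1.
  This is cancelled by the second term in (61), and we obtain the desired expansion."*

[Balaban1987RG1] p. 262: *"(i) 𝐔 = U′U, U has values in the group G, |∂U − 1| < α₀ξ² on X, (1.11) for each cube
□ ⊂ X of a size O(1)LM there exists a G-valued gauge transformation u defined on □ and such, that Uᵘ = exp iξA, |A|,
|∇^ξA| < O(1)LMBα₀ on □, (1.12) with a sufficiently large constant B (it will be determined later). (ii) U′ =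
exp iξA′, A′ has values in the algebra gᶜ, |A′|, |∇^ξ_U A′| < α₁ on X. (1.13)"*
[Balaban1987RG1] p. 263 (render `1987-cmp109-rg-I-small-field-p015`): *"The most important is
  gauge invariance. We assume that all functions 𝐄⁽ʲ⁾(X, g_{j−1}, 𝐔, 𝐉) are gauge invariant with respect to the group
  of all gauge transformations (1.10). Explicitly 𝐄⁽ʲ⁾(X, g_{j−1}, 𝐔ᵘ, R(u)𝐉) = 𝐄⁽ʲ⁾(X, g_{j−1}, 𝐔, 𝐉) (1.19) for all
  Gᶜ-valued gauge transformations u. The spaces Uᶜ_j(X, α₀, α₁) are, by the definition, gauge invariant also."*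
[Balaban1987RG1] p. 283 (render `…-p035`): *"We assume the gauge invariance with respect to Gᶜ-valued gauge transformations, but it is
  implied by the invariance with respect to G-valued transformations, and by the analyticity of the function, as it was
  noticed already."*

[Balaban1988RG2Cluster] p. 21, last paragraph (running on to p. 22; renders `1988-cmp116-rg-II-cluster-p021`,
`…-p022`): *"the expressions (2.14) are gauge invariant with respect to all G-valued transformations. The
expressions are analytic functions of (U,J), hence the invariance can be extended, by the analyticity, to Gᶜ-valued gauge
transformations in a small neighborhood of the space of G-valued ones."* — and: *"This means that the expressions are constant on intersections of orbits with the
corresponding space of configurations (𝐔, 𝐉) satisfying the conditions I.(i)–(iv). We extend them to constant functions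
on whole orbits having non-empty intersections with the space. The above remark completes the proof of the inductive
assumptions for the action A_{k+1}, hence the proof of Theorem I.3."*
-/


noncomputable section

open Metric Set NormedSpace
open scoped Topology

namespace Literature.MathematicalPhysics.QuantumFieldTheory.Balaban1983to89.B10Eq31GlobalConj

open B10Eq61PerSite (DerivZeroAlongV diffAlongV unitSys)
open B10Eq29TubeLine (Tube TubeCfg expLine mem_tube mem_tubeCfg exp_mul_mem_tube cstarAlgebraMatrix
  exp_ofReal_smul_mem_unitary)
open B10Eq61Leaves (expChart derivZeroAlongV_expLine_of_mem_closure logHalfBound_expLine_of_mem_closure)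
open B10Eq29CplxLine (logHalfBound_expLine_cplx_of_mem_closure bound118_secondOrder_expLine_cplx_of_mem_closure)

/-! ## §1. [folklore] The global conjugation action in the exponential chart at the base point `1` -/

section conj

variable {ι : Type*} {𝔸 : Type*} [CStarAlgebra 𝔸]

/-- Bondwise two-sided multiplication `v ↦ (W·v_b·W′)_b` as a continuous ℂ-linear map of configurations (any index
type, any unital C⋆-algebra) — the constant gauge transformation `u ≡ W` of (26) / the global transformation `R(U)`
of (31) read on Lie-algebra-valued configurations, where it is LINEAR. [cite: Balaban1985UV3, (26) p.263, (31) p.264] -/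
def conjCfg (W W' : 𝔸) : (ι → 𝔸) →L[ℂ] (ι → 𝔸) where
  toFun v := fun b => W * v b * W'
  map_add' v w := by
    funext b
    simp only [Pi.add_apply, mul_add, add_mul]
  map_smul' c v := by
    funext b
    simp only [Pi.smul_apply, RingHom.id_apply, mul_smul_comm, smul_mul_assoc]
  cont := continuous_pi fun b => (continuous_const.mul (continuous_apply b)).mul continuous_const

/-- Evaluation of `conjCfg`. [folklore] -/
@[simp] theorem conjCfg_apply (W W' : 𝔸) (v : ι → 𝔸) (b : ι) : conjCfg W W' v b = W * v b * W' := rfl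

/-- The infinitesimal generator `ad_Y : v ↦ (Y·v_b − v_b·Y)_b` of the conjugations, as a continuous ℂ-linear map.
[cite: Balaban1985UV3, (31)–(32) p.264] -/
def adCfg (Y : 𝔸) : (ι → 𝔸) →L[ℂ] (ι → 𝔸) := conjCfg Y 1 - conjCfg 1 Y

/-- Evaluation of `adCfg`. [folklore] -/
@[simp] theorem adCfg_apply (Y : 𝔸) (v : ι → 𝔸) (b : ι) : adCfg Y v b = Y * v b - v b * Y := by
  simp [adCfg]

/-- `ad_Y` of a configuration supported at one bond is the commutator there. [folklore] -/
theorem adCfg_single [DecidableEq ι] (Y x : 𝔸) (b : ι) :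
    adCfg Y (Pi.single b x : ι → 𝔸) = Pi.single b (Y * x - x * Y) := by
  funext b'
  rw [adCfg_apply]
  by_cases h : b' = b
  · subst h
    simp
  · simp [Pi.single_eq_of_ne h]

/-- `exp(c•Y)·exp(c•(−Y)) = 1` (the ℚ-algebra structure Mathlib's `exp_add_of_commute` asks for is supplied inside
the proof by restriction of scalars, as in `B10Eq29TubeLine` §1). [folklore] -/
theorem exp_smul_mul_exp_smul_neg (Y : 𝔸) (c : ℂ) : exp (c • Y) * exp (c • (-Y)) = 1 := by
  letI : NormedAlgebra ℚ 𝔸 := NormedAlgebra.restrictScalars ℚ ℂ 𝔸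
  have hc : Commute (c • Y) (c • (-Y)) := ((Commute.refl Y).neg_right.smul_right _).smul_left _
  rw [← exp_add_of_commute hc, smul_neg, add_neg_cancel, exp_zero]

/-- `exp(c•(−Y))·exp(c•Y) = 1`. [folklore] -/
theorem exp_smul_neg_mul_exp_smul (Y : 𝔸) (c : ℂ) : exp (c • (-Y)) * exp (c • Y) = 1 := by
  letI : NormedAlgebra ℚ 𝔸 := NormedAlgebra.restrictScalars ℚ ℂ 𝔸
  have hc : Commute (c • (-Y)) (c • Y) := ((Commute.refl Y).neg_left.smul_right _).smul_left _
  rw [← exp_add_of_commute hc, smul_neg, neg_add_cancel, exp_zero]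

/-- The exponential intertwines conjugation by an invertible element: `exp(W·x·W′) = W·exp(x)·W′` when
`W·W′ = W′·W = 1` (Mathlib `exp_units_conj`). [folklore] -/
theorem exp_conj_of_mul_eq_one {W W' : 𝔸} (h1 : W * W' = 1) (h2 : W' * W = 1) (x : 𝔸) :
    exp (W * x * W') = W * exp x * W' := by
  letI : NormedAlgebra ℚ 𝔸 := NormedAlgebra.restrictScalars ℚ ℂ 𝔸
  exact exp_units_conj ⟨W, W', h1, h2⟩ x

/-- THE ONE-PARAMETER GROUPS OF THE GLOBAL ACTION IN THE CHART: conjugation by `exp(tY)` (inverse `exp(t(−Y))`),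
bondwise, `t` real, `Y` ANY element (for `Y` skew-adjoint `exp(tY)` is unitary — the compact group `R(U), U ∈ G` of
(31); a general `Y` is the complexified action, [I] p. 283). [cite: Balaban1985UV3, (31) p.264; Balaban1987RG1, p.283] -/
def gaugeFlow (Y : 𝔸) (t : ℝ) : (ι → 𝔸) →L[ℂ] (ι → 𝔸) := conjCfg (exp ((t : ℂ) • Y)) (exp ((t : ℂ) • (-Y)))

/-- Evaluation of `gaugeFlow`. [folklore] -/
theorem gaugeFlow_apply (Y : 𝔸) (t : ℝ) (v : ι → 𝔸) (b : ι) :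
    gaugeFlow Y t v b = exp ((t : ℂ) • Y) * v b * exp ((t : ℂ) • (-Y)) := rfl

/-- Unitary conjugation preserves the one-bond tube `{exp(B)·U}` (isometry of `B ↦ W B W⋆`, `exp` intertwines).
[folklore] -/
theorem conj_mem_tube {a : ℝ} {V W : 𝔸} (hV : V ∈ Tube 𝔸 a) (hW : W ∈ unitary 𝔸) :
    W * V * star W ∈ Tube 𝔸 a := by
  obtain ⟨B, U, hB, hU, rfl⟩ := hV
  have h1 : W * star W = 1 := Unitary.mul_star_self_of_mem hW
  have h2 : star W * W = 1 := Unitary.star_mul_self_of_mem hW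
  refine ⟨W * B * star W, W * U * star W, ?_, ?_, ?_⟩
  · rw [CStarRing.norm_mul_mem_unitary _ (Unitary.star_mem hW), CStarRing.norm_mem_unitary_mul _ hW]
    exact hB
  · exact mul_mem (mul_mem hW hU) (Unitary.star_mem hW)
  · rw [exp_conj_of_mul_eq_one h1 h2 B]
    calc W * (exp B * U) * star W = W * exp B * (star W * W) * U * star W := by
          rw [h2]; noncomm_ring
      _ = W * exp B * star W * (W * U * star W) := by noncomm_ring

/-- … hence the bondwise tube `TubeCfg ι 𝔸 a` is invariant under the constant gauge transformations `V ↦ (W·V_b·W⋆)_b`,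
`W` unitary — both sides of the class-function hypothesis of §3 are evaluated INSIDE the model analyticity domain.
[cite: Balaban1985UV3, (26) p.263; Balaban1987RG1, p.263 ("The spaces … are, by the definition, gauge invariant also")] -/
theorem conj_mem_tubeCfg {a : ℝ} {V : ι → 𝔸} {W : 𝔸} (hV : V ∈ TubeCfg ι 𝔸 a) (hW : W ∈ unitary 𝔸) :
    (fun b => W * V b * star W) ∈ TubeCfg ι 𝔸 a := fun b => conj_mem_tube (hV b) hW

variable {D : LocDomainSys}

/-- THE CHART INTERTWINES: at the base point `1`, `expChart 1 X (conjCfg W W′ v) = (W·expChart 1 X v_b·W′)_b` for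
`W·W′ = W′·W = 1` — the global action is linear in the chart ONLY at the fixed point `U ≡ 1` (the subtraction point
`U_{k+1} = 1` of (61)); at a base point `U₀` not fixed by the action the identity fails (cell GAPS C-adv2-66 R1).
[cite: Balaban1985UV3, (31) p.264, (61) p.271; p.272 (after (63))] -/
theorem expChart_one_conjCfg {W W' : 𝔸} (h1 : W * W' = 1) (h2 : W' * W = 1) (X : D.Dom) (v : ι → 𝔸) :
    expChart (D := D) (fun _ _ => (1 : 𝔸)) X (conjCfg W W' v) =
      fun b => W * expChart (D := D) (fun _ _ => (1 : 𝔸)) X v b * W' := by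
  funext b
  simp only [expChart, conjCfg_apply, mul_one]
  exact exp_conj_of_mul_eq_one h1 h2 (v b)

/-- The same for the one-parameter groups. [folklore] -/
theorem expChart_one_gaugeFlow (Y : 𝔸) (t : ℝ) (X : D.Dom) (v : ι → 𝔸) :
    expChart (D := D) (fun _ _ => (1 : 𝔸)) X (gaugeFlow Y t v) =
      fun b => exp ((t : ℂ) • Y) * expChart (D := D) (fun _ _ => (1 : 𝔸)) X v b * exp ((t : ℂ) • (-Y)) :=
  expChart_one_conjCfg (exp_smul_mul_exp_smul_neg Y t) (exp_smul_neg_mul_exp_smul Y t) X v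

/-- **Velocity of the flow**: `d/dt|₀ exp(tY)·w_b·exp(−tY) = Y w_b − w_b Y` — the `hTd` binder of
`B10Eq61Leaves.derivZeroAlongV_expLine_of_mem_closure`. [folklore] -/
theorem hasDerivAt_gaugeFlow (Y : 𝔸) (w : ι → 𝔸) : HasDerivAt (fun t => gaugeFlow Y t w) (adCfg Y w) 0 := by
  refine hasDerivAt_pi.2 fun b => ?_
  show HasDerivAt (fun t : ℝ => exp ((t : ℂ) • Y) * w b * exp ((t : ℂ) • (-Y))) (adCfg Y w b) 0
  have hof : HasDerivAt (fun t : ℝ => (t : ℂ)) 1 0 := by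
    have h : HasDerivAt (⇑Complex.ofRealCLM) (Complex.ofRealCLM 1) (0 : ℝ) := Complex.ofRealCLM.hasDerivAt
    rw [Complex.ofRealCLM_apply, Complex.ofReal_one] at h
    exact h.congr_of_eventuallyEq (Filter.Eventually.of_forall fun t => (Complex.ofRealCLM_apply t).symm)
  have h1 : HasDerivAt ((fun u : ℂ => exp (u • Y)) ∘ fun t : ℝ => (t : ℂ))
      ((1 : ℂ) • (exp (((0 : ℝ) : ℂ) • Y) * Y)) 0 :=
    (hasDerivAt_exp_smul_const Y ((0 : ℝ) : ℂ)).scomp (0 : ℝ) hof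
  have h2 : HasDerivAt ((fun u : ℂ => exp (u • (-Y))) ∘ fun t : ℝ => (t : ℂ))
      ((1 : ℂ) • (exp (((0 : ℝ) : ℂ) • (-Y)) * (-Y))) 0 :=
    (hasDerivAt_exp_smul_const (-Y) ((0 : ℝ) : ℂ)).scomp (0 : ℝ) hof
  have h3 := (h1.mul_const (w b)).mul h2
  refine h3.congr_deriv ?_
  rw [adCfg_apply]
  simp [sub_eq_add_neg]

/-- For `S` skew-adjoint and `t` real, `exp(tS)⋆ = exp(t(−S))`. [folklore] -/
theorem star_exp_ofReal_smul {S : 𝔸} (hS : S ∈ skewAdjoint 𝔸) (t : ℝ) :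
    star (exp ((t : ℂ) • S)) = exp ((t : ℂ) • (-S)) := by
  rw [star_exp, star_smul, skewAdjoint.mem_iff.mp hS, Complex.star_def, Complex.conj_ofReal]

/-- **CLASS FUNCTIONS**: invariance of every `E X` on the bondwise tube under conjugation by ALL unitaries (the
constant gauge transformations with values in the full unitary group of `𝔸`) gives the flow invariance for the
family of ALL skew-adjoint generators. [cite: Balaban1985UV3, (26) p.263, (31) p.264] -/
theorem flowInvariant_of_classFn {a : ℝ} {E : D.Dom → (ι → 𝔸) → ℂ}
    (hcls : ∀ X, ∀ W ∈ unitary 𝔸, ∀ V ∈ TubeCfg ι 𝔸 a, E X (fun b => W * V b * star W) = E X V)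
    (X : D.Dom) (l : skewAdjoint 𝔸) (t : ℝ) (V : ι → 𝔸) (hV : V ∈ TubeCfg ι 𝔸 a) :
    E X (fun b => exp ((t : ℂ) • (l : 𝔸)) * V b * exp ((t : ℂ) • (-(l : 𝔸)))) = E X V := by
  rw [← star_exp_ofReal_smul l.2 t]
  exact hcls X _ (exp_ofReal_smul_mem_unitary l.2 t) V hV

variable [Fintype ι]

/-- The exponential chart at `1` maps the sup-norm ball of radius `a` into the bondwise tube of half-width `a`.
[folklore] -/
theorem expChart_one_mem_tubeCfg {a : ℝ} (X : D.Dom) {v : ι → 𝔸} (hv : v ∈ ball (0 : ι → 𝔸) a) :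
    expChart (D := D) (fun _ _ => (1 : 𝔸)) X v ∈ TubeCfg ι 𝔸 a := fun b =>
  exp_mul_mem_tube ((norm_le_pi_norm v b).trans_lt (mem_ball_zero_iff.1 hv)) (one_mem _)

/-- **(26) FOR THE ONE-PARAMETER GROUPS ⇒ THE `hinv` BINDER AT THE BASE POINT `1`**: if every `E X` is invariant
on the bondwise tube of half-width `a` under the conjugations by `exp(tY_l)`, then `E X ∘ expChart 1 X` is invariant
under the linear flows `gaugeFlow (Y l) t` on the ball of radius `a`. [cite: Balaban1985UV3, (26) p.263, (31) p.264] -/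
theorem expChart_one_invariant_of_flowInvariant {a : ℝ} {E : D.Dom → (ι → 𝔸) → ℂ} {Λ : Type*} (Y : Λ → 𝔸)
    (hcl : ∀ X l (t : ℝ), ∀ V ∈ TubeCfg ι 𝔸 a,
      E X (fun b => exp ((t : ℂ) • Y l) * V b * exp ((t : ℂ) • (-Y l))) = E X V)
    (X : D.Dom) (l : Λ) (t : ℝ) (v : ι → 𝔸) (hv : v ∈ ball (0 : ι → 𝔸) a) :
    E X (expChart (D := D) (fun _ _ => (1 : 𝔸)) X (gaugeFlow (Y l) t v)) =
      E X (expChart (D := D) (fun _ _ => (1 : 𝔸)) X v) := by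
  rw [expChart_one_gaugeFlow]
  exact hcl X l t _ (expChart_one_mem_tubeCfg X hv)

end conj

/-! ## §2. [folklore] The detected span: per-bond commutators -/

section detected

variable {ι : Type*} {𝔸 : Type*} [CStarAlgebra 𝔸]

/-- A configuration supported at one bond whose value lies in the closed span of the commutators `[Y_l, y]` lies in
the closed span of the ranges of the `ad_{Y_l}` (continuity of `x ↦ Pi.single b x`). [folklore] -/
theorem single_mem_closure_span_range_adCfg {Λ : Type*} [DecidableEq ι] (Y : Λ → 𝔸) (b : ι) {x : 𝔸}
    (hx : x ∈ closure (Submodule.span ℂ {c : 𝔸 | ∃ l y, c = Y l * y - y * Y l} : Set 𝔸)) :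
    (Pi.single b x : ι → 𝔸) ∈
      closure (Submodule.span ℂ (⋃ l, Set.range (adCfg (ι := ι) (Y l))) : Set (ι → 𝔸)) := by
  have hle : Submodule.span ℂ {c : 𝔸 | ∃ l y, c = Y l * y - y * Y l} ≤
      (Submodule.span ℂ (⋃ l, Set.range (adCfg (ι := ι) (Y l)))).comap
        (LinearMap.single ℂ (fun _ : ι => 𝔸) b) := by
    refine Submodule.span_le.2 ?_
    rintro c ⟨l, y, rfl⟩
    refine Submodule.subset_span (Set.mem_iUnion.2 ⟨l, ⟨Pi.single b y, ?_⟩⟩)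
    rw [adCfg_single]
    rfl
  have himg : (fun z : 𝔸 => (Pi.single b z : ι → 𝔸)) ''
      (Submodule.span ℂ {c : 𝔸 | ∃ l y, c = Y l * y - y * Y l} : Set 𝔸) ⊆
      (Submodule.span ℂ (⋃ l, Set.range (adCfg (ι := ι) (Y l))) : Set (ι → 𝔸)) := by
    rintro _ ⟨c, hc, rfl⟩
    exact hle hc
  exact closure_mono himg (image_closure_subset_closure_image (continuous_single b) ⟨x, hx, rfl⟩)

variable [Fintype ι] in
/-- **PER-BOND COMMUTATOR MEMBERSHIP ⇒ THE `hmem` BINDER**: if every bond value `w b` lies in the closed ℂ-span of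
the commutators `{[Y_l, y]}` (the printed `𝓗(B) ∈ 𝔤` with `𝔤 = [𝔤, 𝔤]` semi-simple; [I] (1.13) `A′ ∈ gᶜ`), the
configuration `w` lies in the closed span of the ranges of the flow generators `ad_{Y_l}` (finite sum over bonds).
[cite: Balaban1985UV3, (32) p.264; Balaban1987RG1, (1.13) p.262] -/
theorem mem_closure_span_range_adCfg {Λ : Type*} (Y : Λ → 𝔸) {w : ι → 𝔸}
    (hw : ∀ b, w b ∈ closure (Submodule.span ℂ {c : 𝔸 | ∃ l y, c = Y l * y - y * Y l} : Set 𝔸)) :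
    w ∈ closure (Submodule.span ℂ (⋃ l, Set.range (adCfg (ι := ι) (Y l))) : Set (ι → 𝔸)) := by
  classical
  have hsum : ∑ b, (Pi.single b (w b) : ι → 𝔸) = w := Finset.univ_sum_single w
  have hmem : ∑ b, (Pi.single b (w b) : ι → 𝔸) ∈
      (Submodule.span ℂ (⋃ l, Set.range (adCfg (ι := ι) (Y l)))).topologicalClosure :=
    Submodule.sum_mem _ fun b _ => by
      rw [← SetLike.mem_coe, Submodule.topologicalClosure_coe]
      exact single_mem_closure_span_range_adCfg Y b (hw b)
  rw [← SetLike.mem_coe, Submodule.topologicalClosure_coe, hsum] at hmem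
  exact hmem

variable (𝔸) in
/-- The ℂ-span of the commutators with SKEW-ADJOINT elements, `span{S·y − y·S : S⋆ = −S}` ("`[𝔲(𝔸), 𝔸]`").
[folklore] -/
def commSpan : Submodule ℂ 𝔸 :=
  Submodule.span ℂ {c : 𝔸 | ∃ (l : skewAdjoint 𝔸) (y : 𝔸), c = (l : 𝔸) * y - y * (l : 𝔸)}

/-- `i·H` is skew-adjoint for `H` self-adjoint. [folklore] -/
theorem I_smul_mem_skewAdjoint {H : 𝔸} (hH : star H = H) : Complex.I • H ∈ skewAdjoint 𝔸 := by
  rw [skewAdjoint.mem_iff, star_smul, hH, Complex.star_def, Complex.conj_I, neg_smul]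

/-- `[H, y] = (−i)·[iH, y]`. [folklore] -/
theorem comm_eq_neg_I_smul_comm (H y : 𝔸) :
    H * y - y * H = (-Complex.I) • ((Complex.I • H) * y - y * (Complex.I • H)) := by
  rw [smul_mul_assoc, mul_smul_comm, ← smul_sub, smul_smul, neg_mul, Complex.I_mul_I, neg_neg, one_smul]

/-- **EVERY commutator `[a, y]` lies in `commSpan 𝔸`** (`a = ℜa + i·ℑa` with `ℜa`, `ℑa` self-adjoint, and
`[H, y] = −i·[iH, y]`): over ℂ the skew-adjoint elements already generate all commutators — the model form of
[I] p. 283 (*"implied by the invariance with respect to G-valued transformations"*): `[𝔤ᶜ, ·] ⊆ span_ℂ [𝔤, ·]`.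
[cite: Balaban1987RG1, p.283] -/
theorem comm_mem_commSpan (a y : 𝔸) : a * y - y * a ∈ commSpan 𝔸 := by
  have key : ∀ H : 𝔸, star H = H → H * y - y * H ∈ commSpan 𝔸 := fun H hH => by
    rw [comm_eq_neg_I_smul_comm H y]
    exact Submodule.smul_mem _ _
      (Submodule.subset_span ⟨⟨Complex.I • H, I_smul_mem_skewAdjoint hH⟩, y, rfl⟩)
  have hdec : a * y - y * a = ((realPart a : 𝔸) * y - y * (realPart a : 𝔸)) +
      Complex.I • ((imaginaryPart a : 𝔸) * y - y * (imaginaryPart a : 𝔸)) := by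
    conv_lhs => rw [← realPart_add_I_smul_imaginaryPart a]
    simp only [add_mul, mul_add, smul_mul_assoc, mul_smul_comm, smul_sub]
    abel
  rw [hdec]
  exact Submodule.add_mem _ (key _ (realPart a).2) (Submodule.smul_mem _ _ (key _ (imaginaryPart a).2))

end detected

/-! ## §3. THE JOINT THEOREMS: the subtraction (61) at second order along exponential lines with base point `1`,
the flow binders `hTd` / `hinv` / `hmem` of the lineage DISCHARGED from global-conjugation invariance and per-bond
commutator membership -/

section joint

variable {D : LocDomainSys} {ι : Type*} [Fintype ι] {𝔸 : Type*} [CStarAlgebra 𝔸]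
  {sp' sp : D.Dom → Set (ι → 𝔸)} {E : D.Dom → (ι → 𝔸) → ℂ} {gen : D.Dom → (ι → 𝔸) → ι → 𝔸}
  {nX : D.Dom → ℕ}

/-- **COMPLEX BACKGROUND, FLOW FORM** — `B10Eq29CplxLine.logHalfBound_expLine_cplx_of_mem_closure` at the base
point `1` with the symmetry data SUPPLIED: flows = conjugation by `exp(tY_l)` (ANY family `Y : Λ → 𝔸`), generators
`ad_{Y_l}`, chart radius `a`.  Remaining binders: the generator split (within `p` of a skew-adjoint element of norm
`≤ q(1 + d(X))`, `p < min(1/8, a/2)`), `TubeCfg ι 𝔸 a ⊆ sp X`, holomorphy on `sp X`, invariance of `E X` on the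
bondwise tube under the conjugations by `exp(tY_l)`, per-bond membership of the generator in the closed span of the
commutators `[Y_l, y]`, the undifferenced bound.  Constant `8·((2p + q)/(min(1/8, a/2) − p))²·B`, rate `r − 2`.
[cite: Balaban1985UV3, (26), (28)–(29) p.263, (31)–(32) p.264, (61) p.271, p.272; Balaban1987RG1, (1.12)–(1.13) p.262, p.283] -/
theorem logHalfBound_expLine_cplx_of_flowInvariant {B r a p q : ℝ} (hp : 0 ≤ p) (hq : 0 ≤ q) (hpq : 0 < p + q)
    (hpa : p < min (1 / 8) (a / 2)) (hB : 0 ≤ B)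
    (hsplit : ∀ X φ, φ ∈ sp' X → ∀ b, ∃ S ∈ skewAdjoint 𝔸,
      ‖S‖ ≤ q * (1 + D.dj X) ∧ ‖gen X φ b - S‖ ≤ p)
    (hsp : ∀ X, TubeCfg ι 𝔸 a ⊆ sp X) (hE : ∀ X, DifferentiableOn ℂ (E X) (sp X))
    {Λ : Type*} (Y : Λ → 𝔸)
    (hcl : ∀ X l (t : ℝ), ∀ V ∈ TubeCfg ι 𝔸 a,
      E X (fun b => exp ((t : ℂ) • Y l) * V b * exp ((t : ℂ) • (-Y l))) = E X V)
    (hcomm : ∀ X φ, φ ∈ sp' X → ∀ b,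
      gen X φ b ∈ closure (Submodule.span ℂ {c : 𝔸 | ∃ l y, c = Y l * y - y * Y l} : Set 𝔸))
    (hEb : B13.LogHalfBound D sp E nX B r) :
    B13.LogHalfBound D sp' (diffAlongV E (expLine gen (fun _ _ _ => 1))) nX
      (8 * ((2 * p + q) / (min (1 / 8) (a / 2) - p)) ^ 2 * B) (r - 2) :=
  have ha : 0 < a := by have := min_le_right (1 / 8 : ℝ) (a / 2); linarith
  logHalfBound_expLine_cplx_of_mem_closure (base₀ := fun _ _ => 1) hp hq hpq hpa hB hsplit
    (fun _ _ => one_mem _) hsp hE (fun l t => gaugeFlow (Y l) t) (fun l => adCfg (Y l)) (fun _ => a)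
    (fun _ => ha) (fun l w => hasDerivAt_gaugeFlow (Y l) w)
    (fun X l t v hv _ => expChart_one_invariant_of_flowInvariant Y hcl X l t v hv)
    (fun X φ hφ => mem_closure_span_range_adCfg Y (hcomm X φ hφ)) hEb

/-- **(I.1.18) FOR THE DIFFERENCED (61)-PIECES ALONG COMPLEX BACKGROUNDS, FLOW FORM** ([II]'s letters, printed
R21, `α₁ < min(1/8, a/2)`; symmetry data supplied as in `logHalfBound_expLine_cplx_of_flowInvariant`): constant
`(64A(1 + c₀²)/(min(1/8, a/2) − α₁)²)·c₁`, rate `r − 3`.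
[cite: Balaban1988RG2Cluster, pp.15, 20–21; Balaban1985UV3, (26), (29), (31)–(32) pp.263–264, (61) p.271, p.272; Balaban1987RG1, (1.12)–(1.13) p.262, p.283] -/
theorem bound118_secondOrder_expLine_cplx_of_flowInvariant (c : B13.Consts) (h21 : c.R21)
    (hLM : 1 ≤ (c.L : ℝ) * c.M) (hα₀ : 0 ≤ c.α₀) (hα₁ : 0 < c.α₁) {A a c₀ r c₁ : ℝ} (hA : 0 ≤ A)
    (hc₀ : 0 ≤ c₀) (hα₁a : c.α₁ < min (1 / 8) (a / 2))
    (hsplit : ∀ X φ, φ ∈ sp' X → ∀ b, ∃ S ∈ skewAdjoint 𝔸,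
      ‖S‖ ≤ c₀ * ((c.L : ℝ) * c.M) * c.α₀ * (1 + D.dj X) ∧ ‖gen X φ b - S‖ ≤ c.α₁)
    (hsp : ∀ X, TubeCfg ι 𝔸 a ⊆ sp X) (hE : ∀ X, DifferentiableOn ℂ (E X) (sp X))
    {Λ : Type*} (Y : Λ → 𝔸)
    (hcl : ∀ X l (t : ℝ), ∀ V ∈ TubeCfg ι 𝔸 a,
      E X (fun b => exp ((t : ℂ) • Y l) * V b * exp ((t : ℂ) • (-Y l))) = E X V)
    (hcomm : ∀ X φ, φ ∈ sp' X → ∀ b,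
      gen X φ b ∈ closure (Submodule.span ℂ {c : 𝔸 | ∃ l y, c = Y l * y - y * Y l} : Set 𝔸))
    (hEb : B13.LogHalfBound D sp E nX (A * ((c.L : ℝ) * c.M) ^ 4) r) (hvol : B13.VolBoundK1 D nX c₁)
    (hc₁ : 0 ≤ c₁) :
    B13.Bound118 D sp' (diffAlongV E (expLine gen (fun _ _ _ => 1)))
      (64 * A * (1 + c₀ ^ 2) / (min (1 / 8) (a / 2) - c.α₁) ^ 2 * c₁) (r - 3) :=
  have ha : 0 < a := by have := min_le_right (1 / 8 : ℝ) (a / 2); linarith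
  bound118_secondOrder_expLine_cplx_of_mem_closure (base₀ := fun _ _ => 1) c h21 hLM hα₀ hα₁ hA hc₀ hα₁a
    hsplit (fun _ _ => one_mem _) hsp hE (fun l t => gaugeFlow (Y l) t) (fun l => adCfg (Y l)) (fun _ => a)
    (fun _ => ha) (fun l w => hasDerivAt_gaugeFlow (Y l) w)
    (fun X l t v hv _ => expChart_one_invariant_of_flowInvariant Y hcl X l t v hv)
    (fun X φ hφ => mem_closure_span_range_adCfg Y (hcomm X φ hφ)) hEb hvol hc₁

/-- **REAL BACKGROUND, FLOW FORM** — `B10Eq61Leaves.logHalfBound_expLine_of_mem_closure` at the base point `1`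
with the symmetry data supplied: generator skew-adjoint of norm `≤ p + q(1 + d(X))`, at every bond in the closed span
of the commutators `[Y_l, y]`; `E X` invariant on the bondwise tube of half-width `a ⊆ sp X` under the conjugations
by `exp(tY_l)`, holomorphic on `sp X`; constant `8((p + q)/a)²·B`, rate `r − 2`.
[cite: Balaban1985UV3, (26), (28)–(29) p.263, (31)–(32) p.264, (61) p.271, p.272] -/
theorem logHalfBound_expLine_of_flowInvariant {B r a p q : ℝ} (ha : 0 < a) (hp : 0 ≤ p) (hq : 0 ≤ q)
    (hpq : 0 < p + q) (hB : 0 ≤ B) (hgen : ∀ X φ, φ ∈ sp' X → ∀ b, gen X φ b ∈ skewAdjoint 𝔸)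
    (hbound : ∀ X φ, φ ∈ sp' X → ∀ b, ‖gen X φ b‖ ≤ p + q * (1 + D.dj X)) (hsp : ∀ X, TubeCfg ι 𝔸 a ⊆ sp X)
    (hE : ∀ X, DifferentiableOn ℂ (E X) (sp X)) {Λ : Type*} (Y : Λ → 𝔸)
    (hcl : ∀ X l (t : ℝ), ∀ V ∈ TubeCfg ι 𝔸 a,
      E X (fun b => exp ((t : ℂ) • Y l) * V b * exp ((t : ℂ) • (-Y l))) = E X V)
    (hcomm : ∀ X φ, φ ∈ sp' X → ∀ b,
      gen X φ b ∈ closure (Submodule.span ℂ {c : 𝔸 | ∃ l y, c = Y l * y - y * Y l} : Set 𝔸))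
    (hEb : B13.LogHalfBound D sp E nX B r) :
    B13.LogHalfBound D sp' (diffAlongV E (expLine gen (fun _ _ _ => 1))) nX (8 * ((p + q) / a) ^ 2 * B)
      (r - 2) :=
  logHalfBound_expLine_of_mem_closure (base₀ := fun _ _ => 1) ha hp hq hpq hB hgen (fun _ _ => one_mem _) hbound
    hsp hE (fun l t => gaugeFlow (Y l) t) (fun l => adCfg (Y l)) (fun _ => a) (fun _ => ha)
    (fun l w => hasDerivAt_gaugeFlow (Y l) w)
    (fun X l t v hv _ => expChart_one_invariant_of_flowInvariant Y hcl X l t v hv)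
    (fun X φ hφ => mem_closure_span_range_adCfg Y (hcomm X φ hφ)) hEb

/-- **COMPLEX BACKGROUND, CLASS-FUNCTION FORM**: every `E X` invariant on the bondwise tube under conjugation by
ALL unitaries of `𝔸` (the constant gauge transformations with values in the unitary group of `𝔸`), every bond
generator in the closure of `commSpan 𝔸` (by `comm_mem_commSpan`: of the span of ALL commutators).  Constant
`8·((2p + q)/(min(1/8, a/2) − p))²·B`, rate `r − 2`.
[cite: Balaban1985UV3, (26), (29) p.263, (31)–(32) p.264, (61) p.271, p.272; Balaban1987RG1, (1.13) p.262, p.283] -/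
theorem logHalfBound_expLine_cplx_of_classFn {B r a p q : ℝ} (hp : 0 ≤ p) (hq : 0 ≤ q) (hpq : 0 < p + q)
    (hpa : p < min (1 / 8) (a / 2)) (hB : 0 ≤ B)
    (hsplit : ∀ X φ, φ ∈ sp' X → ∀ b, ∃ S ∈ skewAdjoint 𝔸,
      ‖S‖ ≤ q * (1 + D.dj X) ∧ ‖gen X φ b - S‖ ≤ p)
    (hsp : ∀ X, TubeCfg ι 𝔸 a ⊆ sp X) (hE : ∀ X, DifferentiableOn ℂ (E X) (sp X))
    (hcls : ∀ X, ∀ W ∈ unitary 𝔸, ∀ V ∈ TubeCfg ι 𝔸 a, E X (fun b => W * V b * star W) = E X V)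
    (hcomm : ∀ X φ, φ ∈ sp' X → ∀ b, gen X φ b ∈ closure (commSpan 𝔸 : Set 𝔸))
    (hEb : B13.LogHalfBound D sp E nX B r) :
    B13.LogHalfBound D sp' (diffAlongV E (expLine gen (fun _ _ _ => 1))) nX
      (8 * ((2 * p + q) / (min (1 / 8) (a / 2) - p)) ^ 2 * B) (r - 2) :=
  logHalfBound_expLine_cplx_of_flowInvariant hp hq hpq hpa hB hsplit hsp hE (fun l : skewAdjoint 𝔸 => (l : 𝔸))
    (fun X l t V hV => flowInvariant_of_classFn hcls X l t V hV) hcomm hEb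

/-- **(I.1.18) FOR THE DIFFERENCED (61)-PIECES ALONG COMPLEX BACKGROUNDS, CLASS-FUNCTION FORM** ([II]'s letters,
printed R21, `α₁ < min(1/8, a/2)`): constant `(64A(1 + c₀²)/(min(1/8, a/2) − α₁)²)·c₁`, rate `r − 3`.
[cite: Balaban1988RG2Cluster, pp.15, 20–21; Balaban1985UV3, (26), (29), (31)–(32) pp.263–264, (61) p.271, p.272; Balaban1987RG1, (1.12)–(1.13) p.262, p.283] -/
theorem bound118_secondOrder_expLine_cplx_of_classFn (c : B13.Consts) (h21 : c.R21)
    (hLM : 1 ≤ (c.L : ℝ) * c.M) (hα₀ : 0 ≤ c.α₀) (hα₁ : 0 < c.α₁) {A a c₀ r c₁ : ℝ} (hA : 0 ≤ A)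
    (hc₀ : 0 ≤ c₀) (hα₁a : c.α₁ < min (1 / 8) (a / 2))
    (hsplit : ∀ X φ, φ ∈ sp' X → ∀ b, ∃ S ∈ skewAdjoint 𝔸,
      ‖S‖ ≤ c₀ * ((c.L : ℝ) * c.M) * c.α₀ * (1 + D.dj X) ∧ ‖gen X φ b - S‖ ≤ c.α₁)
    (hsp : ∀ X, TubeCfg ι 𝔸 a ⊆ sp X) (hE : ∀ X, DifferentiableOn ℂ (E X) (sp X))
    (hcls : ∀ X, ∀ W ∈ unitary 𝔸, ∀ V ∈ TubeCfg ι 𝔸 a, E X (fun b => W * V b * star W) = E X V)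
    (hcomm : ∀ X φ, φ ∈ sp' X → ∀ b, gen X φ b ∈ closure (commSpan 𝔸 : Set 𝔸))
    (hEb : B13.LogHalfBound D sp E nX (A * ((c.L : ℝ) * c.M) ^ 4) r) (hvol : B13.VolBoundK1 D nX c₁)
    (hc₁ : 0 ≤ c₁) :
    B13.Bound118 D sp' (diffAlongV E (expLine gen (fun _ _ _ => 1)))
      (64 * A * (1 + c₀ ^ 2) / (min (1 / 8) (a / 2) - c.α₁) ^ 2 * c₁) (r - 3) :=
  bound118_secondOrder_expLine_cplx_of_flowInvariant c h21 hLM hα₀ hα₁ hA hc₀ hα₁a hsplit hsp hE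
    (fun l : skewAdjoint 𝔸 => (l : 𝔸)) (fun X l t V hV => flowInvariant_of_classFn hcls X l t V hV) hcomm hEb
    hvol hc₁

/-- **REAL BACKGROUND, CLASS-FUNCTION FORM**: generator skew-adjoint of norm `≤ p + q(1 + d(X))` in the closure of
`commSpan 𝔸` at every bond, `E X` a class function on the bondwise tube of half-width `a ⊆ sp X`, holomorphic on
`sp X`; constant `8((p + q)/a)²·B`, rate `r − 2`. [cite: Balaban1985UV3, (26), (28)–(29) p.263, (31)–(32) p.264, (61) p.271, p.272] -/
theorem logHalfBound_expLine_of_classFn {B r a p q : ℝ} (ha : 0 < a) (hp : 0 ≤ p) (hq : 0 ≤ q)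
    (hpq : 0 < p + q) (hB : 0 ≤ B) (hgen : ∀ X φ, φ ∈ sp' X → ∀ b, gen X φ b ∈ skewAdjoint 𝔸)
    (hbound : ∀ X φ, φ ∈ sp' X → ∀ b, ‖gen X φ b‖ ≤ p + q * (1 + D.dj X)) (hsp : ∀ X, TubeCfg ι 𝔸 a ⊆ sp X)
    (hE : ∀ X, DifferentiableOn ℂ (E X) (sp X))
    (hcls : ∀ X, ∀ W ∈ unitary 𝔸, ∀ V ∈ TubeCfg ι 𝔸 a, E X (fun b => W * V b * star W) = E X V)
    (hcomm : ∀ X φ, φ ∈ sp' X → ∀ b, gen X φ b ∈ closure (commSpan 𝔸 : Set 𝔸))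
    (hEb : B13.LogHalfBound D sp E nX B r) :
    B13.LogHalfBound D sp' (diffAlongV E (expLine gen (fun _ _ _ => 1))) nX (8 * ((p + q) / a) ^ 2 * B)
      (r - 2) :=
  logHalfBound_expLine_of_flowInvariant ha hp hq hpq hB hgen hbound hsp hE (fun l : skewAdjoint 𝔸 => (l : 𝔸))
    (fun X l t V hV => flowInvariant_of_classFn hcls X l t V hV) hcomm hEb

end joint

/-! ## §4. JOINT NON-VACUITY over `M₂(ℂ)` with the complex part of the background switched ON and NON-COMMUTING:
`E = tr` (a class function), generator `K + E₁₂/16` (`K = iπ(E₁₁ − E₂₂)` skew, `E₁₂/16` nilpotent, not skew,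
`[K, E₁₂] ≠ 0`), every binder of `logHalfBound_expLine_cplx_of_classFn` DERIVED, and the differenced family `= −4` -/

section matrixExample

open scoped Matrix.Norms.L2Operator

open B10Eq61Leaves (M₂ trCLM trCLM_apply mA mC mK mK_eq mK_mem_skewAdjoint mK_ne_zero m2E differentiable_m2E
  example_logHalfBound_m2E)
open B10Eq29CplxLine (mJ mX mX_mem_unitary)

/-- `E₁₁`. [folklore] -/
def mE11 : M₂ := Matrix.of ![![1, 0], ![0, 0]]

/-- `[E₁₁, E₁₂] = E₁₂`: the nilpotent direction is itself a commutator. [folklore] -/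
theorem mE11_comm_mA : mE11 * mA - mA * mE11 = mA := by
  ext i j
  fin_cases i <;> fin_cases j <;> simp [mE11, mA]

/-- `E₁₂² = 0`. [folklore] -/
theorem mA_mul_mA : mA * mA = 0 := by
  ext i j
  fin_cases i <;> fin_cases j <;> simp [mA, Matrix.mul_apply, Fin.sum_univ_two]

/-- `K·E₁₂ ≠ E₁₂·K`: the complex part does NOT commute with the real part. [folklore] -/
theorem mK_mul_mA_ne : mK * mA ≠ mA * mK := by
  intro h
  have h01 := congr_fun (congr_fun h 0) 1
  rw [mK_eq] at h01
  norm_num [mA, Matrix.mul_apply, Fin.sum_univ_two, Matrix.diagonal] at h01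
  have him := congr_arg Complex.im h01
  simp at him
  linarith [Real.pi_pos]

/-- `E₁₂` is not skew-Hermitian (the complex part is genuinely non-unitary). [folklore] -/
theorem mA_not_mem_skewAdjoint : mA ∉ skewAdjoint M₂ := by
  intro h
  rw [skewAdjoint.mem_iff, Matrix.star_eq_conjTranspose] at h
  have h10 := congr_fun (congr_fun h 1) 0
  norm_num [mA, Matrix.conjTranspose_apply] at h10

/-- `J = E₁₂ − E₂₁ ∈ U(2)`. [folklore] -/
theorem mJ_mem_unitary : mJ ∈ unitary M₂ := by
  rw [Unitary.mem_iff, Matrix.star_eq_conjTranspose]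
  constructor <;>
  · ext i j
    fin_cases i <;> fin_cases j <;>
      simp [mJ, Matrix.mul_apply, Fin.sum_univ_two, Matrix.conjTranspose_apply]

/-- `2E₁₂ = σₓ + J`. [folklore] -/
theorem two_smul_mA : (2 : ℂ) • mA = mX + mJ := by
  ext i j
  fin_cases i <;> fin_cases j <;> norm_num [mA, mX, mJ]

/-- `‖E₁₂‖ ≤ 1` (operator norm; `E₁₂` is the mean of two unitaries). [folklore] -/
theorem norm_mA_le : letI := cstarAlgebraMatrix 2; ‖mA‖ ≤ 1 := by
  letI := cstarAlgebraMatrix 2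
  have h : mA = (2 : ℂ)⁻¹ • (mX + mJ) := by
    rw [← two_smul_mA, smul_smul]
    norm_num
  have h1 : ‖mX + mJ‖ ≤ 2 := by
    have := norm_add_le mX mJ
    rw [CStarRing.norm_of_mem_unitary mX_mem_unitary, CStarRing.norm_of_mem_unitary mJ_mem_unitary] at this
    linarith
  rw [h, norm_smul, norm_inv]
  have h2 : ‖(2 : ℂ)‖ = 2 := by simp
  rw [h2]
  linarith [inv_mul_le_iff₀ (show (0 : ℝ) < 2 by norm_num) |>.2 (by linarith : ‖mX + mJ‖ ≤ 2 * 1)]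

/-- The unipotent `W_d = 1 + d·E₁₂` with inverse `1 − d·E₁₂`. [folklore] -/
def unipU (d : ℂ) : M₂ˣ :=
  ⟨1 + d • mA, 1 - d • mA,
    by rw [add_mul, mul_sub, mul_sub, one_mul, one_mul, mul_one, smul_mul_smul_comm, mA_mul_mA, smul_zero,
      sub_zero]; abel,
    by rw [sub_mul, mul_add, mul_add, one_mul, one_mul, mul_one, smul_mul_smul_comm, mA_mul_mA, smul_zero,
      add_zero]; abel⟩

/-- `W_d·K·W_d⁻¹ = K − 2d(iπ)·E₁₂`: the line's generator `K + c·E₁₂` is CONJUGATE to `K` (take `d = −c/(2πi)`).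
[folklore] -/
theorem unipU_conj_mK (d : ℂ) :
    (unipU d : M₂) * mK * ↑(unipU d)⁻¹ = mK + (-(2 * d * (Real.pi * Complex.I))) • mA := by
  show (1 + d • mA) * mK * (1 - d • mA) = mK + (-(2 * d * (Real.pi * Complex.I))) • mA
  rw [mK_eq]
  ext i j
  fin_cases i <;> fin_cases j <;>
    simp [mA, Matrix.mul_apply, Fin.sum_univ_two, Matrix.diagonal, Matrix.one_apply]
  ring

/-- `exp K = −1` (`K = diag(iπ, −iπ)`). [folklore] -/
theorem exp_mK : exp mK = -1 := by
  rw [mK_eq, Matrix.exp_diagonal]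
  have h1 : exp (Real.pi * Complex.I : ℂ) = -1 := by
    rw [← congr_fun Complex.exp_eq_exp_ℂ, Complex.exp_pi_mul_I]
  have h2 : exp (-(Real.pi * Complex.I) : ℂ) = -1 := by
    rw [← congr_fun Complex.exp_eq_exp_ℂ, Complex.exp_neg, Complex.exp_pi_mul_I]; norm_num
  ext i j
  fin_cases i <;> fin_cases j <;> simp [Matrix.diagonal, h1, h2]

/-- **`exp(K + c·E₁₂) = −1` FOR EVERY `c`** (conjugate to `exp K = −1` through the unipotent `W_{−c/(2πi)}`; Mathlib
`exp_units_conj`). [folklore] -/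
theorem exp_mK_add_smul_mA (c : ℂ) : exp (mK + c • mA) = -1 := by
  letI : NormedAlgebra ℚ M₂ := NormedAlgebra.restrictScalars ℚ ℂ M₂
  have hπ : (Real.pi : ℂ) * Complex.I ≠ 0 := mul_ne_zero (by exact_mod_cast Real.pi_ne_zero) Complex.I_ne_zero
  have hd : -(2 * (-c / (2 * (Real.pi * Complex.I))) * (Real.pi * Complex.I)) = c := by
    field_simp
  have hconj : mK + c • mA = (unipU (-c / (2 * (Real.pi * Complex.I))) : M₂) * mK *
      ↑(unipU (-c / (2 * (Real.pi * Complex.I))))⁻¹ := by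
    rw [unipU_conj_mK, hd]
  rw [hconj, exp_units_conj, exp_mK, mul_neg, mul_one, neg_mul, Units.mul_inv]

/-- `tr` is a CLASS FUNCTION: `tr(W V W⋆) = tr(W⋆ W V) = tr V` for `W ∈ U(2)` — (26) for the constant gauge
transformations, for the example family `E = tr`. [cite: Balaban1985UV3, (26) p.263, (31) p.264] -/
theorem m2E_conj (X : unitSys.Dom) {W : M₂} (hW : W ∈ unitary M₂) (V : Unit → M₂) :
    m2E X (fun b => W * V b * star W) = m2E X V := by
  simp only [m2E, trCLM_apply]
  rw [Matrix.trace_mul_cycle, Unitary.star_mul_self_of_mem hW, one_mul]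

/-- `E₂₁`. [folklore] -/
def mE21 : M₂ := Matrix.of ![![0, 0], ![1, 0]]

/-- `[E₂₁, E₁₁] = E₂₁`. [folklore] -/
theorem mE21_comm_mE11 : mE21 * mE11 - mE11 * mE21 = mE21 := by
  ext i j
  fin_cases i <;> fin_cases j <;> simp [mE11, mE21]

/-- `[E₁₂, E₂₁] = E₁₁ − E₂₂`. [folklore] -/
theorem mA_comm_mE21 : mA * mE21 - mE21 * mA = Matrix.diagonal ![1, -1] := by
  ext i j
  fin_cases i <;> fin_cases j <;> simp [mA, mE21]

/-- **THE DETECTED SPAN OF `M₂(ℂ)` IS `𝔰𝔩₂ = 𝔰𝔲(2)ᶜ`**: `commSpan M₂(ℂ)` = the traceless matrices (`⊆`: a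
commutator is traceless; `⊇`: `P = P₀₁E₁₂ + P₁₀E₂₁ + P₀₀(E₁₁ − E₂₂)` and each of `E₁₂ = [E₁₁, E₁₂]`,
`E₂₁ = [E₂₁, E₁₁]`, `E₁₁ − E₂₂ = [E₁₂, E₂₁]` is a commutator, `comm_mem_commSpan`).  The centre `ℂ·1` is NOT
detected (`B10Eq61Leaves.example_fderiv_apply_center`): *"by the assumption that 𝔤 is semi-simple, the only element
invariant is 0"* holds for `𝔰𝔲(2)`, not for `𝔲(2)`. [cite: Balaban1985UV3, (32) p.264] -/
theorem coe_commSpan_m2 :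
    letI := cstarAlgebraMatrix 2
    (commSpan M₂ : Set M₂) = {P | Matrix.trace P = 0} := by
  letI := cstarAlgebraMatrix 2
  refine Set.Subset.antisymm ?_ ?_
  · have hle : commSpan M₂ ≤ LinearMap.ker (Matrix.traceLinearMap (Fin 2) ℂ ℂ) := by
      refine Submodule.span_le.2 ?_
      rintro _ ⟨S, y, rfl⟩
      simp [Matrix.trace_mul_comm (S : M₂) y]
    intro P hP
    simpa using hle hP
  · intro P hP
    have h11 : P 1 1 = -P 0 0 := by
      have hP' : P 0 0 + P 1 1 = 0 := by simpa [Matrix.trace_fin_two] using hP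
      linear_combination hP'
    have hdec : P = P 0 1 • mA + P 1 0 • mE21 + P 0 0 • (mA * mE21 - mE21 * mA) := by
      rw [mA_comm_mE21]
      ext i j
      fin_cases i <;> fin_cases j <;> simp [mA, mE21, h11]
    have hA : mA ∈ commSpan M₂ := by
      have h := comm_mem_commSpan (𝔸 := M₂) mE11 mA
      rwa [mE11_comm_mA] at h
    have h21 : mE21 ∈ commSpan M₂ := by
      have h := comm_mem_commSpan (𝔸 := M₂) mE21 mE11
      rwa [mE21_comm_mE11] at h
    show P ∈ commSpan M₂
    rw [hdec]
    exact Submodule.add_mem _ (Submodule.add_mem _ (Submodule.smul_mem _ _ hA) (Submodule.smul_mem _ _ h21))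
      (Submodule.smul_mem _ _ (comm_mem_commSpan mA mE21))

/-- THE EXAMPLE GENERATOR WITH THE COMPLEX PART ON: `K + E₁₂/16` — real part `K` skew of norm `‖K‖` (= `π`),
complex part `E₁₂/16` NOT skew and NOT commuting with `K`. [folklore] -/
def m2GenC (_X : unitSys.Dom) (_φ : Unit → M₂) (_b : Unit) : M₂ := mK + (16 : ℂ)⁻¹ • mA

/-- The split binder: within `1/16` of the skew element `K` of norm `≤ ‖K‖·(1 + d)`. [folklore] -/
theorem m2GenC_split (X : unitSys.Dom) (φ : Unit → M₂) (b : Unit) :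
    letI := cstarAlgebraMatrix 2
    ∃ S ∈ skewAdjoint M₂, ‖S‖ ≤ ‖mK‖ * (1 + unitSys.dj X) ∧ ‖m2GenC X φ b - S‖ ≤ 1 / 16 := by
  letI := cstarAlgebraMatrix 2
  refine ⟨mK, mK_mem_skewAdjoint, by simp [unitSys], ?_⟩
  have h : m2GenC X φ b - mK = (16 : ℂ)⁻¹ • mA := by simp [m2GenC]
  have h16 : ‖(16 : ℂ)‖ = 16 := by simp
  rw [h, norm_smul, norm_inv, h16]
  have := norm_mA_le
  linarith [inv_mul_le_iff₀ (show (0 : ℝ) < 16 by norm_num) |>.2 (by linarith : ‖mA‖ ≤ 16 * (1 / 16))]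

/-- The commutator binder: `K + E₁₂/16 = [A, C] + [E₁₁, E₁₂]/16 ∈ commSpan M₂(ℂ)` (`comm_mem_commSpan`). [folklore] -/
theorem m2GenC_mem_closure (X : unitSys.Dom) (φ : Unit → M₂) (b : Unit) :
    letI := cstarAlgebraMatrix 2
    m2GenC X φ b ∈ closure (commSpan M₂ : Set M₂) := by
  letI := cstarAlgebraMatrix 2
  refine subset_closure ?_
  show mA * mC - mC * mA + (16 : ℂ)⁻¹ • mA ∈ commSpan M₂
  refine Submodule.add_mem _ (comm_mem_commSpan mA mC) (Submodule.smul_mem _ _ ?_)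
  have h := comm_mem_commSpan (𝔸 := M₂) mE11 mA
  rwa [mE11_comm_mA] at h

/-- **JOINT NON-VACUITY, COMPLEX PART ON, NON-COMMUTING, UNIFORM IN THE REAL PART**: every binder of
`logHalfBound_expLine_cplx_of_classFn` holds for the `M₂(ℂ)` data (evaluation space = everything, analyticity space =
the bondwise tube of half-width `a = 1`, `p = 1/16`, `q = ‖K‖`, `B = 3‖tr‖`, `r = 0`, class function `tr`,
generator `K + E₁₂/16` in `commSpan`), giving the differenced bound with constant
`8·((2/16 + ‖K‖)/(min(1/8, 1/2) − 1/16))²·3‖tr‖`. [folklore] -/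
theorem example_logHalfBound_expLine_cplx_m2 :
    letI := cstarAlgebraMatrix 2
    B13.LogHalfBound unitSys (fun _ => univ) (diffAlongV m2E (expLine m2GenC (fun _ _ _ => 1))) (fun _ => 1)
      (8 * ((2 * (1 / 16) + ‖mK‖) / (min (1 / 8) (1 / 2) - 1 / 16)) ^ 2 * (3 * ‖trCLM‖)) (0 - 2) := by
  letI := cstarAlgebraMatrix 2
  exact logHalfBound_expLine_cplx_of_classFn (sp := fun _ => TubeCfg Unit M₂ 1) (a := 1) (q := ‖mK‖)
    (p := 1 / 16) (by norm_num) (norm_nonneg _) (by positivity) (lt_min (by norm_num) (by norm_num))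
    (by positivity) (fun X φ _ b => m2GenC_split X φ b) (fun _ => Subset.rfl)
    (fun X => (differentiable_m2E X).differentiableOn) (fun X W hW V _ => m2E_conj X hW V)
    (fun X φ _ b => m2GenC_mem_closure X φ b) example_logHalfBound_m2E

/-- **…and non-degenerately**: the differenced family at the configuration `1` is `tr exp(K + E₁₂/16) − tr 1 =
tr(−1) − tr 1 = −4 ≠ 0` — the second-order bound is attained by a genuinely complex, non-commuting background.
[folklore] -/
theorem example_diffAlongV_cplx_m2 (X : unitSys.Dom) :
    letI := cstarAlgebraMatrix 2
    diffAlongV m2E (expLine m2GenC (fun _ _ _ => 1)) X (fun _ => 1) = -4 := by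
  letI := cstarAlgebraMatrix 2
  simp only [diffAlongV, expLine, m2E, m2GenC, one_smul, zero_smul, exp_zero, mul_one, trCLM_apply,
    exp_mK_add_smul_mA, Matrix.trace_neg, Matrix.trace_one, Fintype.card_fin]
  norm_num

end matrixExample

end Literature.MathematicalPhysics.QuantumFieldTheory.Balaban1983to89.B10Eq31GlobalConj
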